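import Mathlib
import Literature.NumberTheory.GaloisRepresentations.CyclicNormIndex
import HarnessLib

/-!
# Chevalley's ambiguous-class step: `3 ∤ h_L` for a cyclic cubic extension `L/F`

Final step of the ambiguous-class argument (Chevalley 1933; Honda 1971 §2) for a cyclic cubic
extension `L/F` of number fields with group `⟨σ⟩`: if
(i) every element of `L` whose norm is a unit of `F` has the norm of a UNIT of `L`, and
(ii) every nonzero `σ`-invariant ideal of `𝓞 L` is principal,
then `3 ∤ h_L`.

* `mk0_eq_one_of_mk0_smul_eq` — an invariant ideal CLASS is trivial: from `(x)·σI = (y)·I`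
  one gets `N(y/x) ∈ 𝓞_Fˣ`, so by (i) and the cyclic Hilbert 90 of the tree
  (`CyclicNormIndex.exists_eq_div_of_norm_eq_one`) `y/x = ε·σ(w)/w` with `w ∈ 𝓞 L`, and
  `J = (σw)(σ²w)·I` is a `σ`-invariant ideal in the class of `I`, principal by (ii).
* `stub_classNumber_not_dvd` — `I ↦ σ • I` induces a map `f` of the finite set `Cl(L)`
  (`exists_classMap`) with `f³ = 1` and the single fixed point `1`, so `h_L ≡ 1 (mod 3)`
  (`Equiv.Perm.card_fixedPoints_modEq`).
-/

set_option linter.dupNamespace false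

open NumberField

open scoped Pointwise NumberField nonZeroDivisors

namespace Summit.QuantumAdvantage.QuantumAdvantage.Theorems.LinnikCubicClassGroups

/-! ### The pointwise action on nonzero ideals and on ideal classes -/

section ClassMap

variable {M R : Type*} [Group M] [CommRing R] [MulSemiringAction M R]

/-- `σ • (x) = (σ x)` for the pointwise action of ring automorphisms on ideals. [folklore] -/
theorem pointwise_smul_span_singleton (a : M) (x : R) :
    a • Ideal.span ({x} : Set R) = Ideal.span {a • x} := by
  rw [Ideal.smul_closure, Set.smul_set_singleton]

/-- The pointwise action of a group on ideals preserves being nonzero. [folklore] -/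
theorem pointwise_smul_ne_bot (a : M) {I : Ideal R} (hI : I ≠ ⊥) : a • I ≠ ⊥ := by
  intro h
  apply hI
  rw [← Ideal.smul_bot a] at h
  exact smul_left_cancel a h

variable [IsDedekindDomain R]

/-- `σ • I` is again a nonzero ideal (membership in the monoid `(Ideal R)⁰`). [folklore] -/
theorem smul_mem_nonZeroDivisors (a : M) (I : (Ideal R)⁰) : a • (I : Ideal R) ∈ (Ideal R)⁰ :=
  mem_nonZeroDivisors_of_ne_zero (pointwise_smul_ne_bot a (nonZeroDivisors.ne_zero I.2))

/-- `I ↦ σ • I` respects ideal classes: `(x)·I = (y)·I'` gives `(σx)·σI = (σy)·σI'`. [folklore] -/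
theorem mk0_smul_eq_of_mk0_eq (a : M) {I I' : (Ideal R)⁰}
    (h : ClassGroup.mk0 I = ClassGroup.mk0 I') :
    ClassGroup.mk0 ⟨a • (I : Ideal R), smul_mem_nonZeroDivisors a I⟩ =
      ClassGroup.mk0 ⟨a • (I' : Ideal R), smul_mem_nonZeroDivisors a I'⟩ := by
  rw [ClassGroup.mk0_eq_mk0_iff] at h ⊢
  obtain ⟨x, y, hx, hy, hxy⟩ := h
  refine ⟨a • x, a • y, (smul_ne_zero_iff_ne a).mpr hx, (smul_ne_zero_iff_ne a).mpr hy, ?_⟩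
  change Ideal.span {a • x} * a • (I : Ideal R) = Ideal.span {a • y} * a • (I' : Ideal R)
  rw [← pointwise_smul_span_singleton, ← pointwise_smul_span_singleton, ← smul_mul', ← smul_mul',
    hxy]

/-- The map `[I] ↦ [σ • I]` of the ideal class group induced by a ring automorphism `σ` exists
(as an endofunction of the underlying set; well defined by `mk0_smul_eq_of_mk0_eq`). [folklore] -/
theorem exists_classMap (a : M) : ∃ f : Function.End (ClassGroup R), ∀ I : (Ideal R)⁰,
    f (ClassGroup.mk0 I) = ClassGroup.mk0 ⟨a • (I : Ideal R), smul_mem_nonZeroDivisors a I⟩ :=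
  ⟨fun c => ClassGroup.mk0 ⟨a • _,
      smul_mem_nonZeroDivisors a (Function.surjInv ClassGroup.mk0_surjective c)⟩,
    fun I =>
      mk0_smul_eq_of_mk0_eq a (Function.surjInv_eq ClassGroup.mk0_surjective (ClassGroup.mk0 I))⟩

end ClassMap

/-! ### Units of `𝓞 L` lying in `F` -/

/-- An element of `F` which, in `L`, is a unit of `𝓞 L` is (the image of) a unit of `𝓞 F`:
integrality descends along the injection `F → L`, for the element and for its inverse.
[folklore] -/
theorem exists_units_coe_eq_of_algebraMap_eq {F L : Type*} [Field F] [Field L] [Algebra F L]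
    {a : F} (u : (𝓞 L)ˣ) (h : algebraMap F L a = ((u : 𝓞 L) : L)) :
    ∃ v : (𝓞 F)ˣ, ((v : 𝓞 F) : F) = a := by
  have hu0 : ((u : 𝓞 L) : L) ≠ 0 := RingOfIntegers.coe_ne_zero_iff.mpr u.ne_zero
  have ha0 : a ≠ 0 := by
    rintro rfl
    rw [map_zero] at h
    exact hu0 h.symm
  have ha : IsIntegral ℤ a := by
    refine IsIntegral.tower_bot_of_field (B := L) ?_
    rw [h]
    exact RingOfIntegers.isIntegral_coe _
  have hb : IsIntegral ℤ a⁻¹ := by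
    refine IsIntegral.tower_bot_of_field (B := L) ?_
    rw [map_inv₀, h, RingOfIntegers.coe_eq_algebraMap, ← map_units_inv]
    exact RingOfIntegers.isIntegral_coe _
  refine ⟨Units.mkOfMulEqOne (⟨a, ha⟩ : 𝓞 F) ⟨a⁻¹, hb⟩ ?_, rfl⟩
  apply RingOfIntegers.coe_injective
  rw [map_mul, map_one, RingOfIntegers.map_mk, RingOfIntegers.map_mk, mul_inv_cancel₀ ha0]

/-! ### Cyclic cubic extensions: `σ³ = 1` and `N = x · σx · σ²x` -/

section Cubic

variable {F L : Type*} [Field F] [NumberField F] [Field L] [NumberField L] [Algebra F L]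
  [IsGalois F L] {σ : L ≃ₐ[F] L}

/-- A generator of the Galois group of a cubic Galois extension has `σ³ = 1`. [folklore] -/
theorem pow_three_eq_one_of_finrank_eq_three (hσ : ∀ τ : L ≃ₐ[F] L, τ ∈ Subgroup.zpowers σ)
    (h3 : Module.finrank F L = 3) : σ ^ 3 = 1 := by
  rw [← h3, ← IsGalois.card_aut_eq_finrank F L, ← orderOf_eq_card_of_forall_mem_zpowers hσ]
  exact pow_orderOf_eq_one σ

/-- In a cyclic cubic extension with group `⟨σ⟩`, `N_{L/F}(z) = z · σz · σ²z`. [folklore] -/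
theorem algebraMap_norm_eq_of_finrank_eq_three (hσ : ∀ τ : L ≃ₐ[F] L, τ ∈ Subgroup.zpowers σ)
    (h3 : Module.finrank F L = 3) (z : L) :
    algebraMap F L (Algebra.norm F z) = z * σ z * σ (σ z) := by
  rw [Algebra.norm_eq_prod_automorphisms,
    ← Literature.NumberTheory.GaloisRepresentations.CyclicNormIndex.prod_range_card_pow_eq_prod hσ
      (fun g => g z), IsGalois.card_aut_eq_finrank F L, h3]
  simp [Finset.prod_range_succ]

/-! ### An invariant class is trivial -/

/-- **Chevalley's ambiguous-class step.** Let `L/F` be cyclic cubic with group `⟨σ⟩` such that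
(i) every `x ∈ L` whose norm is a unit of `F` has the norm of a unit of `L` and (ii) every nonzero
`σ`-invariant ideal of `𝓞 L` is principal. Then every `σ`-invariant ideal class is trivial:
if `[σ • I] = [I]`, i.e. `(x)·σI = (y)·I`, then `N(y/x) ∈ 𝓞_Fˣ`, so by (i) and Hilbert 90
`y/x = ε σ(w)/w` with `w ∈ 𝓞 L`, `(w)·σI = (σw)·I`, and `J = (σw)(σ²w)·I` is a `σ`-invariant ideal
in the class of `I`, principal by (ii). [folklore] -/
theorem mk0_eq_one_of_mk0_smul_eq (hσ : ∀ τ : L ≃ₐ[F] L, τ ∈ Subgroup.zpowers σ)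
    (h3 : Module.finrank F L = 3)
    (hN : ∀ x : L, (∃ u : (𝓞 F)ˣ, Algebra.norm F x = ((u : 𝓞 F) : F)) →
      ∃ ε : (𝓞 L)ˣ, Algebra.norm F (((ε : 𝓞 L) : L)) = Algebra.norm F x)
    (hP : ∀ I : Ideal (𝓞 L), I ≠ ⊥ → σ • I = I → Submodule.IsPrincipal I)
    (I : (Ideal (𝓞 L))⁰)
    (h : ClassGroup.mk0 ⟨σ • (I : Ideal (𝓞 L)), smul_mem_nonZeroDivisors σ I⟩ = ClassGroup.mk0 I) :
    ClassGroup.mk0 I = 1 := by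
  classical
  have hσ3 : σ ^ 3 = 1 := pow_three_eq_one_of_finrank_eq_three hσ h3
  have hnorm : ∀ x : 𝓞 L,
      algebraMap F L (Algebra.norm F (x : L)) = ((x * σ • x * σ • σ • x : 𝓞 L) : L) := fun x => by
    rw [algebraMap_norm_eq_of_finrank_eq_three hσ h3]
    rfl
  obtain ⟨I, hI0⟩ := I
  have hI : I ≠ ⊥ := nonZeroDivisors.ne_zero hI0
  rw [ClassGroup.mk0_eq_mk0_iff] at h
  obtain ⟨x, y, hx, hy, hxy⟩ := h
  change Ideal.span {x} * σ • I = Ideal.span {y} * I at hxy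
  -- `σ³ = 1` on ideals and on integers
  have hσI : σ • σ • σ • I = I := by
    rw [smul_smul, smul_smul, ← pow_three', hσ3, one_smul]
  -- the two conjugate relations
  have h1 : Ideal.span {σ • x} * σ • σ • I = Ideal.span {σ • y} * σ • I := by
    have := congrArg (σ • ·) hxy
    simpa only [smul_mul', pointwise_smul_span_singleton] using this
  have h2 : Ideal.span {σ • σ • x} * I = Ideal.span {σ • σ • y} * σ • σ • I := by
    have := congrArg (σ • ·) h1
    simpa only [smul_mul', pointwise_smul_span_singleton, hσI] using this
  -- multiply the three relations and cancel `I · σI · σ²I`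
  have hII : I * σ • I * σ • σ • I ≠ 0 :=
    mul_ne_zero (mul_ne_zero hI (pointwise_smul_ne_bot σ hI))
      (pointwise_smul_ne_bot σ (pointwise_smul_ne_bot σ hI))
  have hNN : Ideal.span {x * σ • x * σ • σ • x} = Ideal.span {y * σ • y * σ • σ • y} := by
    apply mul_right_cancel₀ hII
    calc Ideal.span {x * σ • x * σ • σ • x} * (I * σ • I * σ • σ • I)
        = (Ideal.span {x} * σ • I) * (Ideal.span {σ • x} * σ • σ • I) *
            (Ideal.span {σ • σ • x} * I) := by
          rw [← Ideal.span_singleton_mul_span_singleton, ← Ideal.span_singleton_mul_span_singleton]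
          ring
      _ = (Ideal.span {y} * I) * (Ideal.span {σ • y} * σ • I) *
            (Ideal.span {σ • σ • y} * σ • σ • I) := by rw [hxy, h1, h2]
      _ = Ideal.span {y * σ • y * σ • σ • y} * (I * σ • I * σ • σ • I) := by
          rw [← Ideal.span_singleton_mul_span_singleton, ← Ideal.span_singleton_mul_span_singleton]
          ring
  obtain ⟨u, hu⟩ := Ideal.span_singleton_eq_span_singleton.mp hNN
  -- in `L`: `N(y/x) = u` is a unit of `𝓞 L` lying in `F`, hence a unit of `𝓞 F`
  have hx' : (x : L) ≠ 0 := RingOfIntegers.coe_ne_zero_iff.mpr hx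
  have hNx0 : ((x * σ • x * σ • σ • x : 𝓞 L) : L) ≠ 0 :=
    RingOfIntegers.coe_ne_zero_iff.mpr
      (mul_ne_zero (mul_ne_zero hx ((smul_ne_zero_iff_ne σ).mpr hx))
        ((smul_ne_zero_iff_ne σ).mpr ((smul_ne_zero_iff_ne σ).mpr hx)))
  have hdiv : ∀ a b : L, Algebra.norm F (a / b) = Algebra.norm F a / Algebra.norm F b :=
    fun a b => by rw [div_eq_mul_inv, map_mul, Algebra.norm_inv, div_eq_mul_inv]
  have hz : algebraMap F L (Algebra.norm F ((y : L) / x)) = ((u : 𝓞 L) : L) := by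
    rw [hdiv, map_div₀, hnorm, hnorm, ← hu, div_eq_iff hNx0]
    exact (map_mul _ _ _).trans (mul_comm _ _)
  obtain ⟨v, hv⟩ := exists_units_coe_eq_of_algebraMap_eq u hz
  -- by (i), `N(y/x) = N(ε)` for a unit `ε` of `𝓞 L`; then `y/(xε)` has norm `1`
  obtain ⟨ε, hε⟩ := hN ((y : L) / x) ⟨v, hv.symm⟩
  have hε0 : ((ε : 𝓞 L) : L) ≠ 0 := RingOfIntegers.coe_ne_zero_iff.mpr ε.ne_zero
  have hz0 : Algebra.norm F ((y : L) / x) ≠ 0 := by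
    intro h0
    rw [h0, map_zero] at hz
    exact (RingOfIntegers.coe_ne_zero_iff.mpr u.ne_zero) hz.symm
  have h1' : Algebra.norm F ((y : L) / x / ε) = 1 := by
    rw [hdiv, hε, div_self hz0]
  -- Hilbert 90, and an integral representative `w`
  obtain ⟨w₀, hw₀, hw₀'⟩ :=
    Literature.NumberTheory.GaloisRepresentations.CyclicNormIndex.exists_eq_div_of_norm_eq_one
      hσ h1'
  obtain ⟨d, hd, hdint⟩ := exists_integral_multiples ℤ ℚ ({w₀} : Finset L)
  have hdw : IsIntegral ℤ ((d : L) * w₀) := by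
    have := hdint w₀ (Finset.mem_singleton_self w₀)
    rwa [Algebra.smul_def, eq_intCast] at this
  set w : 𝓞 L := ⟨(d : L) * w₀, hdw⟩ with hwdef
  have hw : (w : L) = (d : L) * w₀ := rfl
  have hd' : (d : L) ≠ 0 := Int.cast_ne_zero.mpr hd
  have hwne : (w : L) ≠ 0 := by rw [hw]; exact mul_ne_zero hd' hw₀
  have hwne' : w ≠ 0 := RingOfIntegers.coe_ne_zero_iff.mp hwne
  have hσw : σ (w : L) / w = σ w₀ / w₀ := by
    rw [hw, map_mul, map_intCast, mul_div_mul_left _ _ hd']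
  -- `w · y = x · ε · σw` in `𝓞 L`
  have hrel : (w : L) * y = x * (ε * σ (w : L)) := by
    have h := hw₀'.trans hσw.symm
    rw [div_div, div_eq_div_iff (mul_ne_zero hx' hε0) hwne] at h
    linear_combination h
  have hrelO : w * y = x * ((ε : 𝓞 L) * σ • w) := by
    apply RingOfIntegers.coe_injective
    simp only [map_mul]
    exact hrel
  -- `(w)·σI = (σw)·I`
  have hwI : Ideal.span {w} * σ • I = Ideal.span {σ • w} * I := by
    have hsx : Ideal.span ({x} : Set (𝓞 L)) ≠ 0 := by
      rw [Ne, Ideal.zero_eq_bot, Ideal.span_singleton_eq_bot]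
      exact hx
    apply mul_left_cancel₀ hsx
    calc Ideal.span {x} * (Ideal.span {w} * σ • I)
        = Ideal.span {w} * (Ideal.span {x} * σ • I) := by ring
      _ = Ideal.span {w} * (Ideal.span {y} * I) := by rw [hxy]
      _ = Ideal.span {w * y} * I := by rw [← mul_assoc, Ideal.span_singleton_mul_span_singleton]
      _ = Ideal.span {x * ((ε : 𝓞 L) * σ • w)} * I := by rw [hrelO]
      _ = Ideal.span {x} * (Ideal.span {σ • w} * I) := by
          rw [← Ideal.span_singleton_mul_span_singleton,
            Ideal.span_singleton_mul_left_unit ε.isUnit, mul_assoc]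
  -- the invariant ideal `J = (σw)(σ²w)·I` in the class of `I`
  have hσw3 : σ • σ • σ • w = w := by
    rw [smul_smul, smul_smul, ← pow_three', hσ3, one_smul]
  set J : Ideal (𝓞 L) := Ideal.span {σ • w} * Ideal.span {σ • σ • w} * I with hJ
  have hJσ : σ • J = J := by
    rw [hJ, smul_mul', smul_mul', pointwise_smul_span_singleton, pointwise_smul_span_singleton,
      hσw3, mul_assoc, hwI, ← mul_assoc, mul_comm (Ideal.span {σ • σ • w})]
  have hsw : ∀ t : 𝓞 L, t ≠ 0 → Ideal.span ({t} : Set (𝓞 L)) ≠ ⊥ := fun t ht => by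
    rw [Ne, Ideal.span_singleton_eq_bot]
    exact ht
  have hw1 : σ • w ≠ 0 := (smul_ne_zero_iff_ne σ).mpr hwne'
  have hw2 : σ • σ • w ≠ 0 := (smul_ne_zero_iff_ne σ).mpr hw1
  have hJ0 : J ≠ ⊥ := mul_ne_zero (mul_ne_zero (hsw _ hw1) (hsw _ hw2)) hI
  have hJmem : J ∈ (Ideal (𝓞 L))⁰ := mem_nonZeroDivisors_of_ne_zero hJ0
  have hIJ : ClassGroup.mk0 ⟨I, hI0⟩ = ClassGroup.mk0 ⟨J, hJmem⟩ := by
    rw [ClassGroup.mk0_eq_mk0_iff]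
    refine ⟨σ • w * σ • σ • w, 1, mul_ne_zero hw1 hw2, one_ne_zero, ?_⟩
    show Ideal.span {σ • w * σ • σ • w} * I = Ideal.span {1} * J
    rw [Ideal.span_singleton_one, Ideal.top_mul, hJ, ← Ideal.span_singleton_mul_span_singleton]
  rw [hIJ]
  exact (ClassGroup.mk0_eq_one_iff hJmem).mpr (hP J hJ0 hJσ)

end Cubic

/-! ### The stub: `3 ∤ h_L` -/

/-- **`3 ∤ h_L` (Chevalley's ambiguous-class count).** For a cyclic cubic extension `L/F` of
number fields with group `⟨σ⟩` satisfying (i) every element of `L` whose norm is a unit of `F`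
has the norm of a unit of `L` and (ii) every nonzero `σ`-invariant ideal of `𝓞 L` is principal,
the class number of `L` is prime to `3`: by `mk0_eq_one_of_mk0_smul_eq` the only `σ`-fixed
ideal class is `1`, and `[I] ↦ [σ • I]` is an endofunction `f` of the finite set `Cl(L)` with
`f³ = 1`, so `h_L ≡ #Fix(f) = 1 (mod 3)` (`Equiv.Perm.card_fixedPoints_modEq`). [folklore] -/
theorem stub_classNumber_not_dvd :
    ∀ (F L : Type) [Field F] [NumberField F] [Field L] [NumberField L] [Algebra F L]
      [IsGalois F L] (σ : L ≃ₐ[F] L), (∀ τ : L ≃ₐ[F] L, τ ∈ Subgroup.zpowers σ) →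
      Module.finrank F L = 3 →
      (∀ x : L, (∃ u : (𝓞 F)ˣ, Algebra.norm F x = ((u : 𝓞 F) : F)) →
        ∃ ε : (𝓞 L)ˣ, Algebra.norm F (((ε : 𝓞 L) : L)) = Algebra.norm F x) →
      (∀ I : Ideal (𝓞 L), I ≠ ⊥ → σ • I = I → Submodule.IsPrincipal I) →
      ¬ 3 ∣ classNumber L := by
  intro F L _ _ _ _ _ _ σ hσ h3 hN hP
  classical
  have hσ3 : σ ^ 3 = 1 := pow_three_eq_one_of_finrank_eq_three hσ h3
  -- `f = ([I] ↦ [σ • I])` has `f ^ 3 = 1` ...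
  obtain ⟨f, hf⟩ := exists_classMap (R := 𝓞 L) σ
  have hf3 : f ^ 3 ^ 1 = 1 := by
    rw [pow_one]
    funext c
    obtain ⟨I, rfl⟩ := ClassGroup.mk0_surjective c
    show f (f (f (ClassGroup.mk0 I))) = ClassGroup.mk0 I
    rw [hf, hf, hf]
    congr 1
    refine Subtype.ext ?_
    show σ • σ • σ • (I : Ideal (𝓞 L)) = I
    rw [smul_smul, smul_smul, ← pow_three', hσ3, one_smul]
  have hmod := Equiv.Perm.card_fixedPoints_modEq hf3
  -- ... and exactly one fixed point
  have hone : Fintype.card (Function.fixedPoints f) = 1 := by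
    rw [Fintype.card_eq_one_iff]
    refine ⟨⟨1, ?_⟩, ?_⟩
    · show f 1 = 1
      rw [← map_one ClassGroup.mk0, hf]
      congr 1
      exact Subtype.ext (smul_one σ)
    · rintro ⟨c, hc⟩
      obtain ⟨I, rfl⟩ := ClassGroup.mk0_surjective c
      refine Subtype.ext (mk0_eq_one_of_mk0_smul_eq hσ h3 hN hP I ?_)
      rw [← hf]
      exact hc
  rw [hone] at hmod
  intro hdvd
  unfold classNumber at hdvd
  unfold Nat.ModEq at hmod
  omega

end Summit.QuantumAdvantage.QuantumAdvantage.Theorems.LinnikCubicClassGroups
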